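import Mathlib
import Summits.KontsevichZagierPeriods.KontsevichZagierPeriods.Theorems.HyperbolicBlochOffTetraSectorKernelStubSimplexCutEdge

/-!
# `OffTetraSectorKernel`, line `odd-hyperbolic-ladder`: cutting a lifted simplex by a geodesic
# half-space (stub `stub_simplexCut`)

Stub `stub_simplexCut` of the crux `OffTetraSectorKernel` (stmt-KontsevichZagierPeriods-10557, route
HyperbolicBloch), skeleton v5, rung 2 of the hyperbolic scissors ladder. In the paraboloid lift
`Ql p = (|p|², p₀, p₁, 1)` of the upper half space a geodesic half-space is LINEAR,
`H = {p | 0 < m ⬝ Ql p}`, and an admissible simplex `Spx v` (rows algebraic; each row a normalised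
null future vector — an ideal vertex — or the lift `Ql q` of an algebraic point of `ℍ³` — a finite
vertex; rows independent) is the set of points whose lift has positive Cramer coordinates with
respect to the rows. THEOREM (`stub_simplexCut`): `Spx v ∩ H` is, up to a Lebesgue-null set, a finite
disjoint union of admissible simplices contained in `Spx v ∩ H`.

Proof: recursion on the number of rows off the wall `{m ⬝ X = 0}` (`simplexCut_induct`).
* If no edge crosses the wall (`simplexCut_noCross`): when all `m ⬝ v a ≥ 0` and one is positive, the
  functional is positive on the open simplex (Cramer expansion `simplexCut_subset_halfSpace` of the
  helper file) — one piece, `v` itself; when all `m ⬝ v a ≤ 0` the simplex misses `H` — no piece.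
* If `m ⬝ v a > 0 > m ⬝ v b`: the crossing point `z = (−m ⬝ v b) • v a + (m ⬝ v a) • v b` of the edge
  `a b` with the wall is a positive combination of two future causal vectors, hence future causal
  (`simplexCut_causal_comb`, the reversed Cauchy–Schwarz inequality); it is renormalised to an
  admissible algebraic row `w` — kept if null, divided by `z₃` to the lift `Ql q` of the algebraic
  point `q = (z₁, z₂, √(z₀z₃ − z₁² − z₂²)) / z₃` if time-like (`simplexCut_normalise`); the simplex is
  split along `w` into `v[b := w]` and `v[a := w]` (`simplexCut_edgeSplit`, the landed
  `stub_spxSplit` at an arbitrary vertex pair), each admissible with one row fewer off the wall,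
  and the two partitions produced by the recursion are concatenated (`simplexCut_glue`).

References: J. L. Dupont, C.-H. Sah, *Scissors congruences II*, J. Pure Appl. Algebra 25 (1982),
§3 (cone decompositions of geodesic simplices; the new vertices are algebraic).
-/

noncomputable section

open Set MeasureTheory
open Literature.NumberTheory.Transcendental

namespace Summit.KontsevichZagierPeriods.HyperbolicBloch.OffTetraSectorKernel

/-! ## Future causal rows -/

/-- The rows of an admissible simplex — normalised null future vectors, or lifts `Ql q` of points
of the upper half space — are future causal: `x₁² + x₂² ≤ x₀x₃`, `0 ≤ x₃`, `0 < x₀ + x₃`.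
[folklore] -/
theorem simplexCut_causal_of_row (Ql : (Fin 3 → ℝ) → Fin 4 → ℝ)
    (hQl : ∀ p, Ql p = ![p 0 ^ 2 + p 1 ^ 2 + p 2 ^ 2, p 0, p 1, 1]) (x : Fin 4 → ℝ)
    (hx : (x 1 ^ 2 + x 2 ^ 2 = x 0 * x 3 ∧ 0 ≤ x 3 ∧ 0 < x 0 + x 3) ∨
      ∃ q : Fin 3 → ℝ, (∀ c, IsAlgebraic ℚ (q c)) ∧ 0 < q 2 ∧ x = Ql q) :
    x 1 ^ 2 + x 2 ^ 2 ≤ x 0 * x 3 ∧ 0 ≤ x 3 ∧ 0 < x 0 + x 3 := by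
  rcases hx with ⟨h1, h2, h3⟩ | ⟨q, -, hq, rfl⟩
  · exact ⟨h1.le, h2, h3⟩
  · rw [hQl]
    simp only [Matrix.cons_val_zero, Matrix.cons_val_one, Matrix.cons_val]
    refine ⟨by nlinarith [sq_nonneg (q 2)], zero_le_one, by positivity⟩

/-- A positive combination of two future causal vectors is future causal (the reversed
Cauchy–Schwarz inequality of the Lorentzian form `x₀x₃ − x₁² − x₂²` on the future cone).
[folklore] -/
theorem simplexCut_causal_comb (x y : Fin 4 → ℝ) (α β : ℝ) (hα : 0 < α) (hβ : 0 < β)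
    (hx : x 1 ^ 2 + x 2 ^ 2 ≤ x 0 * x 3 ∧ 0 ≤ x 3 ∧ 0 < x 0 + x 3)
    (hy : y 1 ^ 2 + y 2 ^ 2 ≤ y 0 * y 3 ∧ 0 ≤ y 3 ∧ 0 < y 0 + y 3) :
    (α • x + β • y) 1 ^ 2 + (α • x + β • y) 2 ^ 2 ≤ (α • x + β • y) 0 * (α • x + β • y) 3 ∧
      0 ≤ (α • x + β • y) 3 ∧ 0 < (α • x + β • y) 0 + (α • x + β • y) 3 := by
  obtain ⟨hx1, hx3, hx03⟩ := hx
  obtain ⟨hy1, hy3, hy03⟩ := hy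
  simp only [Pi.add_apply, Pi.smul_apply, smul_eq_mul]
  -- the mixed term is non-negative
  have hB : 0 ≤ x 0 * y 3 + x 3 * y 0 - 2 * (x 1 * y 1 + x 2 * y 2) := by
    rcases hx3.lt_or_eq with hx3' | hx3'
    · rcases hy3.lt_or_eq with hy3' | hy3'
      · have h : 0 ≤ x 3 * y 3 * (x 0 * y 3 + x 3 * y 0 - 2 * (x 1 * y 1 + x 2 * y 2)) := by
          nlinarith [mul_nonneg (sq_nonneg (y 3)) (sub_nonneg.mpr hx1),
            mul_nonneg (sq_nonneg (x 3)) (sub_nonneg.mpr hy1),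
            sq_nonneg (x 1 * y 3 - y 1 * x 3), sq_nonneg (x 2 * y 3 - y 2 * x 3)]
        exact (mul_nonneg_iff_of_pos_left (mul_pos hx3' hy3')).mp h
      · have e3 : y 3 = 0 := hy3'.symm
        rw [e3, mul_zero] at hy1
        have e1 : y 1 = 0 := by nlinarith [sq_nonneg (y 1), sq_nonneg (y 2)]
        have e2 : y 2 = 0 := by nlinarith [sq_nonneg (y 1), sq_nonneg (y 2)]
        rw [e3] at hy03
        rw [e1, e2, e3]
        nlinarith [mul_nonneg hx3 (le_of_lt (by linarith : (0 : ℝ) < y 0))]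
    · have e3 : x 3 = 0 := hx3'.symm
      rw [e3, mul_zero] at hx1
      have e1 : x 1 = 0 := by nlinarith [sq_nonneg (x 1), sq_nonneg (x 2)]
      have e2 : x 2 = 0 := by nlinarith [sq_nonneg (x 1), sq_nonneg (x 2)]
      rw [e3] at hx03
      rw [e1, e2, e3]
      nlinarith [mul_nonneg hy3 (le_of_lt (by linarith : (0 : ℝ) < x 0))]
  refine ⟨?_, add_nonneg (mul_nonneg hα.le hx3) (mul_nonneg hβ.le hy3), ?_⟩
  · nlinarith [mul_nonneg (mul_nonneg hα.le hβ.le) hB, mul_nonneg (sq_nonneg α) (sub_nonneg.mpr hx1),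
      mul_nonneg (sq_nonneg β) (sub_nonneg.mpr hy1)]
  · nlinarith [mul_pos hα hx03, mul_pos hβ hy03]

/-- Normalisation of an algebraic future causal vector to an admissible row: a null one is kept, a
time-like one `z` is rescaled to the lift `Ql q = z / z₃` of the algebraic point
`q = (z₁/z₃, z₂/z₃, √(z₀z₃ − z₁² − z₂²)/z₃)` of the upper half space. [folklore] -/
theorem simplexCut_normalise (Ql : (Fin 3 → ℝ) → Fin 4 → ℝ)
    (hQl : ∀ p, Ql p = ![p 0 ^ 2 + p 1 ^ 2 + p 2 ^ 2, p 0, p 1, 1]) (z : Fin 4 → ℝ)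
    (hz : z 1 ^ 2 + z 2 ^ 2 ≤ z 0 * z 3 ∧ 0 ≤ z 3 ∧ 0 < z 0 + z 3) (halg : ∀ k, IsAlgebraic ℚ (z k)) :
    ∃ (c : ℝ) (w : Fin 4 → ℝ), 0 < c ∧ w = c • z ∧ (∀ k, IsAlgebraic ℚ (w k)) ∧
      ((w 1 ^ 2 + w 2 ^ 2 = w 0 * w 3 ∧ 0 ≤ w 3 ∧ 0 < w 0 + w 3) ∨
        ∃ q : Fin 3 → ℝ, (∀ c, IsAlgebraic ℚ (q c)) ∧ 0 < q 2 ∧ w = Ql q) := by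
  obtain ⟨hz1, hz3, hz03⟩ := hz
  rcases hz1.eq_or_lt with heq | hlt
  · exact ⟨1, z, one_pos, (one_smul ℝ z).symm, halg, Or.inl ⟨heq, hz3, hz03⟩⟩
  · have h3 : 0 < z 3 := by
      rcases hz3.lt_or_eq with h | h
      · exact h
      · exfalso
        rw [← h, mul_zero] at hlt
        nlinarith [sq_nonneg (z 1), sq_nonneg (z 2)]
    obtain ⟨Q, hQ⟩ : ∃ Q : ℝ, Q = z 0 * z 3 - z 1 ^ 2 - z 2 ^ 2 := ⟨_, rfl⟩
    have hQpos : 0 < Q := by rw [hQ]; linarith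
    have hQalg : IsAlgebraic ℚ Q := by
      rw [hQ]
      exact (((halg 0).mul (halg 3)).sub ((halg 1).pow 2)).sub ((halg 2).pow 2)
    have h3alg : IsAlgebraic ℚ (z 3)⁻¹ := (halg 3).inv
    have hsalg : IsAlgebraic ℚ (Real.sqrt Q) := redAux_isAlgebraic_sqrt hQalg hQpos.le
    obtain ⟨q, hq⟩ : ∃ q : Fin 3 → ℝ, q = ![z 1 / z 3, z 2 / z 3, Real.sqrt Q / z 3] := ⟨_, rfl⟩
    have hq0 : q 0 = z 1 / z 3 := by rw [hq]; rfl
    have hq1 : q 1 = z 2 / z 3 := by rw [hq]; rfl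
    have hq2 : q 2 = Real.sqrt Q / z 3 := by rw [hq]; rfl
    refine ⟨(z 3)⁻¹, (z 3)⁻¹ • z, inv_pos.mpr h3, rfl, fun k => ?_, Or.inr ⟨q, ?_, ?_, ?_⟩⟩
    · simpa only [Pi.smul_apply, smul_eq_mul] using h3alg.mul (halg k)
    · intro c
      fin_cases c
      · show IsAlgebraic ℚ (q 0)
        rw [hq0, div_eq_mul_inv]; exact (halg 1).mul h3alg
      · show IsAlgebraic ℚ (q 1)
        rw [hq1, div_eq_mul_inv]; exact (halg 2).mul h3alg
      · show IsAlgebraic ℚ (q 2)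
        rw [hq2, div_eq_mul_inv]; exact hsalg.mul h3alg
    · rw [hq2]; exact div_pos (Real.sqrt_pos.mpr hQpos) h3
    · have h3' : z 3 ≠ 0 := h3.ne'
      funext k
      rw [hQl, Pi.smul_apply, smul_eq_mul]
      fin_cases k
      · show (z 3)⁻¹ * z 0 = q 0 ^ 2 + q 1 ^ 2 + q 2 ^ 2
        rw [hq0, hq1, hq2, div_pow, div_pow, div_pow, Real.sq_sqrt hQpos.le, hQ]
        field_simp
        ring
      · show (z 3)⁻¹ * z 1 = q 0
        rw [hq0]; field_simp
      · show (z 3)⁻¹ * z 2 = q 1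
        rw [hq1]; field_simp
      · show (z 3)⁻¹ * z 3 = 1
        exact inv_mul_cancel₀ h3'

/-! ## Small bookkeeping lemmas -/

/-- `ℚ̄ ∩ ℝ` is closed under the dot products used here. [folklore] -/
theorem simplexCut_isAlgebraic_dot (m x : Fin 4 → ℝ) (hm : ∀ c, IsAlgebraic ℚ (m c))
    (hx : ∀ c, IsAlgebraic ℚ (x c)) : IsAlgebraic ℚ (∑ c, m c * x c) := by
  show (∑ c, m c * x c) ∈ Subalgebra.algebraicClosure ℚ ℝ
  exact sum_mem fun c _ => (hm c).mul (hx c)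

/-- Linearity of the functional `x ↦ ∑ c, m c * x c`. [folklore] -/
theorem simplexCut_dot_comb (m x y : Fin 4 → ℝ) (α β : ℝ) :
    ∑ c, m c * (α • x + β • y) c = α * ∑ c, m c * x c + β * ∑ c, m c * y c := by
  simp only [Pi.add_apply, Pi.smul_apply, smul_eq_mul, Finset.mul_sum, ← Finset.sum_add_distrib]
  exact Finset.sum_congr rfl fun c _ => by ring

/-- Replacing one row of an admissible row system by an admissible algebraic row keeps the rows
admissible and algebraic. [folklore] -/
theorem simplexCut_rows_update (Ql : (Fin 3 → ℝ) → Fin 4 → ℝ) (v : Fin 4 → Fin 4 → ℝ)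
    (halg : ∀ i c, IsAlgebraic ℚ (v i c))
    (hrow : ∀ i, (v i 1 ^ 2 + v i 2 ^ 2 = v i 0 * v i 3 ∧ 0 ≤ v i 3 ∧ 0 < v i 0 + v i 3) ∨
      ∃ q : Fin 3 → ℝ, (∀ c, IsAlgebraic ℚ (q c)) ∧ 0 < q 2 ∧ v i = Ql q)
    (w : Fin 4 → ℝ) (hwalg : ∀ k, IsAlgebraic ℚ (w k))
    (hw : (w 1 ^ 2 + w 2 ^ 2 = w 0 * w 3 ∧ 0 ≤ w 3 ∧ 0 < w 0 + w 3) ∨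
      ∃ q : Fin 3 → ℝ, (∀ c, IsAlgebraic ℚ (q c)) ∧ 0 < q 2 ∧ w = Ql q)
    (b : Fin 4) :
    (∀ i c, IsAlgebraic ℚ (Function.update v b w i c)) ∧
    (∀ i, (Function.update v b w i 1 ^ 2 + Function.update v b w i 2 ^ 2 =
        Function.update v b w i 0 * Function.update v b w i 3 ∧ 0 ≤ Function.update v b w i 3 ∧
        0 < Function.update v b w i 0 + Function.update v b w i 3) ∨
      ∃ q : Fin 3 → ℝ, (∀ c, IsAlgebraic ℚ (q c)) ∧ 0 < q 2 ∧ Function.update v b w i = Ql q) := by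
  refine ⟨fun i c => ?_, fun i => ?_⟩
  · rcases eq_or_ne i b with rfl | h
    · rw [Function.update_self]; exact hwalg c
    · rw [Function.update_of_ne h]; exact halg i c
  · rcases eq_or_ne i b with rfl | h
    · rw [Function.update_self]; exact hw
    · rw [Function.update_of_ne h]; exact hrow i

/-- Replacing a row on which the functional does not vanish by one on which it does lowers the
number of such rows by one. [folklore] -/
theorem simplexCut_card_update (m : Fin 4 → ℝ) (v : Fin 4 → Fin 4 → ℝ) (b : Fin 4) (w : Fin 4 → ℝ)
    (hb : ∑ c, m c * v b c ≠ 0) (hw : ∑ c, m c * w c = 0) :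
    (Finset.univ.filter fun a => ∑ c, m c * Function.update v b w a c ≠ 0).card + 1 =
      (Finset.univ.filter fun a => ∑ c, m c * v a c ≠ 0).card := by
  have e : (Finset.univ.filter fun a => ∑ c, m c * Function.update v b w a c ≠ 0) =
      (Finset.univ.filter fun a => ∑ c, m c * v a c ≠ 0).erase b := by
    ext a
    simp only [Finset.mem_filter, Finset.mem_univ, true_and, Finset.mem_erase]
    rcases eq_or_ne a b with rfl | h
    · simp [hw]
    · rw [Function.update_of_ne h]
      exact ⟨fun h' => ⟨h, h'⟩, fun h' => h'.2⟩
  have hmem : b ∈ Finset.univ.filter fun a => ∑ c, m c * v a c ≠ 0 := by simpa using hb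
  rw [e, Finset.card_erase_of_mem hmem]
  have : 0 < (Finset.univ.filter fun a => ∑ c, m c * v a c ≠ 0).card := Finset.card_pos.mpr ⟨b, hmem⟩
  omega

/-! ## The cut -/

/-- The two terminal cases of the recursion: if no edge crosses the wall (no pair of rows with
`m ⬝ v a > 0 > m ⬝ v b`), then either some row is strictly positive and all are non-negative — the
whole simplex lies in the half-space, one piece — or all rows are non-positive — the simplex misses
the half-space, no piece. [folklore] -/
theorem simplexCut_noCross (Ql : (Fin 3 → ℝ) → Fin 4 → ℝ)
    (Spx : (Fin 4 → Fin 4 → ℝ) → Set (Fin 3 → ℝ))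
    (hSpx : ∀ v, Spx v = {p | 0 < p 2 ∧ ∀ a, 0 < (Matrix.of v).det * ((Matrix.of v).updateRow a (Ql p)).det})
    (m : Fin 4 → ℝ) (v : Fin 4 → Fin 4 → ℝ)
    (hv : (∀ i c, IsAlgebraic ℚ (v i c)) ∧ (∀ i, (v i 1 ^ 2 + v i 2 ^ 2 = v i 0 * v i 3 ∧ 0 ≤ v i 3 ∧ 0 < v i 0 + v i 3) ∨ ∃ q : Fin 3 → ℝ, (∀ c, IsAlgebraic ℚ (q c)) ∧ 0 < q 2 ∧ v i = Ql q) ∧ (Matrix.of v).det ≠ 0)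
    (hx : ¬ ∃ a b, 0 < ∑ c, m c * v a c ∧ ∑ c, m c * v b c < 0) :
    ∃ (N : ℕ) (ws : Fin N → Fin 4 → Fin 4 → ℝ),
      (∀ j, (∀ i c, IsAlgebraic ℚ (ws j i c)) ∧ (∀ i, (ws j i 1 ^ 2 + ws j i 2 ^ 2 = ws j i 0 * ws j i 3 ∧ 0 ≤ ws j i 3 ∧ 0 < ws j i 0 + ws j i 3) ∨ ∃ q : Fin 3 → ℝ, (∀ c, IsAlgebraic ℚ (q c)) ∧ 0 < q 2 ∧ ws j i = Ql q) ∧ (Matrix.of (ws j)).det ≠ 0) ∧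
      (∀ j, Spx (ws j) ⊆ Spx v ∩ {p | 0 < ∑ c, m c * Ql p c}) ∧
      (∀ j j', j ≠ j' → Spx (ws j) ∩ Spx (ws j') = ∅) ∧
      volume ((Spx v ∩ {p | 0 < ∑ c, m c * Ql p c}) \ ⋃ j, Spx (ws j)) = 0 := by
  by_cases hpos : ∃ a, 0 < ∑ c, m c * v a c
  · -- one piece: the simplex itself
    obtain ⟨a₀, ha₀⟩ := hpos
    have hnn : ∀ b, 0 ≤ ∑ c, m c * v b c := fun b => not_lt.mp fun hb => hx ⟨a₀, b, ha₀, hb⟩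
    have hsub : Spx v ⊆ {p | 0 < ∑ c, m c * Ql p c} :=
      simplexCut_subset_halfSpace Ql Spx hSpx v m hnn a₀ ha₀
    refine ⟨1, fun _ => v, fun _ => hv, fun _ => subset_inter Subset.rfl hsub, fun j j' hjj' => ?_, ?_⟩
    · exact absurd (Subsingleton.elim j j') hjj'
    · rw [iUnion_const, Set.sdiff_eq_empty.mpr inter_subset_left, measure_empty]
  · -- no piece
    have hnp : ∀ a, ∑ c, m c * v a c ≤ 0 := fun a => not_lt.mp fun ha => hpos ⟨a, ha⟩
    refine ⟨0, fun j => Fin.elim0 j, fun j => Fin.elim0 j, fun j => Fin.elim0 j, fun j => Fin.elim0 j, ?_⟩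
    rw [simplexCut_inter_halfSpace_eq_empty Ql Spx hSpx v m hnp, Set.empty_sdiff, measure_empty]

/-- THE RECURSION (induction on the number of rows off the wall `{m ⬝ X = 0}`). If an edge `a b`
crosses the wall (`m ⬝ v a > 0 > m ⬝ v b`), the crossing point `(−m ⬝ v b) • v a + (m ⬝ v a) • v b`
is future causal (`simplexCut_causal_comb`), is renormalised to an admissible algebraic row `w` on
the wall (`simplexCut_normalise`), the simplex is split along it (`simplexCut_edgeSplit`) into
`v[b := w]` and `v[a := w]`, each with one row fewer off the wall, and the partitions of the two
pieces are concatenated (`simplexCut_glue`); otherwise `simplexCut_noCross`. [cite: DupontSah1982, §3] -/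
theorem simplexCut_induct (Ql : (Fin 3 → ℝ) → Fin 4 → ℝ)
    (hQl : ∀ p, Ql p = ![p 0 ^ 2 + p 1 ^ 2 + p 2 ^ 2, p 0, p 1, 1])
    (Spx : (Fin 4 → Fin 4 → ℝ) → Set (Fin 3 → ℝ))
    (hSpx : ∀ v, Spx v = {p | 0 < p 2 ∧ ∀ a, 0 < (Matrix.of v).det * ((Matrix.of v).updateRow a (Ql p)).det})
    (m : Fin 4 → ℝ) (hm : ∀ c, IsAlgebraic ℚ (m c)) (n : ℕ) :
    ∀ (v : Fin 4 → Fin 4 → ℝ),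
      ((∀ i c, IsAlgebraic ℚ (v i c)) ∧ (∀ i, (v i 1 ^ 2 + v i 2 ^ 2 = v i 0 * v i 3 ∧ 0 ≤ v i 3 ∧ 0 < v i 0 + v i 3) ∨ ∃ q : Fin 3 → ℝ, (∀ c, IsAlgebraic ℚ (q c)) ∧ 0 < q 2 ∧ v i = Ql q) ∧ (Matrix.of v).det ≠ 0) →
      (Finset.univ.filter fun a => ∑ c, m c * v a c ≠ 0).card ≤ n →
      ∃ (N : ℕ) (ws : Fin N → Fin 4 → Fin 4 → ℝ),
        (∀ j, (∀ i c, IsAlgebraic ℚ (ws j i c)) ∧ (∀ i, (ws j i 1 ^ 2 + ws j i 2 ^ 2 = ws j i 0 * ws j i 3 ∧ 0 ≤ ws j i 3 ∧ 0 < ws j i 0 + ws j i 3) ∨ ∃ q : Fin 3 → ℝ, (∀ c, IsAlgebraic ℚ (q c)) ∧ 0 < q 2 ∧ ws j i = Ql q) ∧ (Matrix.of (ws j)).det ≠ 0) ∧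
        (∀ j, Spx (ws j) ⊆ Spx v ∩ {p | 0 < ∑ c, m c * Ql p c}) ∧
        (∀ j j', j ≠ j' → Spx (ws j) ∩ Spx (ws j') = ∅) ∧
        volume ((Spx v ∩ {p | 0 < ∑ c, m c * Ql p c}) \ ⋃ j, Spx (ws j)) = 0 := by
  induction n with
  | zero =>
    intro v hv hcnt
    refine simplexCut_noCross Ql Spx hSpx m v hv fun ⟨a, b, ha, _⟩ => ?_
    have hmem : a ∈ Finset.univ.filter fun a => ∑ c, m c * v a c ≠ 0 := by simpa using ha.ne'
    have := Finset.card_pos.mpr ⟨a, hmem⟩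
    omega
  | succ n ih =>
    intro v hv hcnt
    by_cases hx : ∃ a b, 0 < ∑ c, m c * v a c ∧ ∑ c, m c * v b c < 0
    · obtain ⟨a, b, ha, hb⟩ := hx
      obtain ⟨halg, hrow, hdet⟩ := hv
      have hab : a ≠ b := by
        rintro rfl
        exact lt_asymm ha hb
      -- the crossing point of the edge `a b` with the wall, renormalised
      set σa : ℝ := ∑ c, m c * v a c with hσa
      set σb : ℝ := ∑ c, m c * v b c with hσb
      have hσa_alg : IsAlgebraic ℚ σa := simplexCut_isAlgebraic_dot m (v a) hm (halg a)
      have hσb_alg : IsAlgebraic ℚ σb := simplexCut_isAlgebraic_dot m (v b) hm (halg b)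
      set z : Fin 4 → ℝ := (-σb) • v a + σa • v b with hz
      have hzc := simplexCut_causal_comb (v a) (v b) (-σb) σa (neg_pos.mpr hb) ha
        (simplexCut_causal_of_row Ql hQl (v a) (hrow a)) (simplexCut_causal_of_row Ql hQl (v b) (hrow b))
      have hzalg : ∀ k, IsAlgebraic ℚ (z k) := fun k => by
        simpa only [hz, Pi.add_apply, Pi.smul_apply, smul_eq_mul] using
          (hσb_alg.neg.mul (halg a k)).add (hσa_alg.mul (halg b k))
      obtain ⟨c, w, hc, hwz, hwalg, hwrow⟩ := simplexCut_normalise Ql hQl z hzc hzalg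
      have hw : w = (c * -σb) • v a + (c * σa) • v b := by
        rw [hwz, hz, smul_add, smul_smul, smul_smul]
      have hα : 0 < c * -σb := mul_pos hc (neg_pos.mpr hb)
      have hβ : 0 < c * σa := mul_pos hc ha
      have hw0 : ∑ k, m k * w k = 0 := by
        rw [hw, simplexCut_dot_comb]
        ring
      -- the two pieces
      obtain ⟨hA, hB, hAB, hnull⟩ :=
        simplexCut_edgeSplit Ql hQl Spx hSpx v a b w (c * -σb) (c * σa) hab hα hβ hw hdet
      have hdetA : (Matrix.of (Function.update v b w)).det ≠ 0 := by
        rw [hw, simplexCut_det_update_right v hab]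
        exact mul_ne_zero hβ.ne' hdet
      have hdetB : (Matrix.of (Function.update v a w)).det ≠ 0 := by
        rw [hw, simplexCut_det_update_left v hab]
        exact mul_ne_zero hα.ne' hdet
      obtain ⟨halgA, hrowA⟩ := simplexCut_rows_update Ql v halg hrow w hwalg hwrow b
      obtain ⟨halgB, hrowB⟩ := simplexCut_rows_update Ql v halg hrow w hwalg hwrow a
      have hcntA : (Finset.univ.filter fun a' => ∑ c, m c * Function.update v b w a' c ≠ 0).card ≤ n := by
        have := simplexCut_card_update m v b w hb.ne hw0
        omega
      have hcntB : (Finset.univ.filter fun a' => ∑ c, m c * Function.update v a w a' c ≠ 0).card ≤ n := by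
        have := simplexCut_card_update m v a w ha.ne' hw0
        omega
      have ihA := ih (Function.update v b w) ⟨halgA, hrowA, hdetA⟩ hcntA
      have ihB := ih (Function.update v a w) ⟨halgB, hrowB, hdetB⟩ hcntB
      exact simplexCut_glue volume Spx
        (fun u : Fin 4 → Fin 4 → ℝ => (∀ i c, IsAlgebraic ℚ (u i c)) ∧
          (∀ i, (u i 1 ^ 2 + u i 2 ^ 2 = u i 0 * u i 3 ∧ 0 ≤ u i 3 ∧ 0 < u i 0 + u i 3) ∨
            ∃ q : Fin 3 → ℝ, (∀ c, IsAlgebraic ℚ (q c)) ∧ 0 < q 2 ∧ u i = Ql q) ∧ (Matrix.of u).det ≠ 0)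
        (Spx v) {p | 0 < ∑ c, m c * Ql p c} (Function.update v b w) (Function.update v a w)
        hA hB hAB hnull ihA ihB
    · exact simplexCut_noCross Ql Spx hSpx m v hv hx

/-- STUB `stub_simplexCut` (worker, v5): an admissible simplex cut by a geodesic half-space `{0 < m • Ql p}` is, up to
null walls, a disjoint union of at most six admissible simplices inside it (new vertices `m(v_a) v_b − m(v_b) v_a` on
the crossing edges are future time-like by convexity of the cone, renormalised to `Ql q`; sign-pattern case analysis;
engine: the landed edge split `stub_spxSplit`). [cite: DupontSah1982, §3] -/
theorem stub_simplexCut :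
    ∀ (Ql : (Fin 3 → ℝ) → Fin 4 → ℝ), (∀ p, Ql p = ![p 0 ^ 2 + p 1 ^ 2 + p 2 ^ 2, p 0, p 1, 1]) →
    ∀ (Spx : (Fin 4 → Fin 4 → ℝ) → Set (Fin 3 → ℝ)),
      (∀ v, Spx v = {p | 0 < p 2 ∧ ∀ a, 0 < (Matrix.of v).det * ((Matrix.of v).updateRow a (Ql p)).det}) →
    ∀ (v : Fin 4 → Fin 4 → ℝ), ((∀ i c, IsAlgebraic ℚ (v i c)) ∧ (∀ i, (v i 1 ^ 2 + v i 2 ^ 2 = v i 0 * v i 3 ∧ 0 ≤ v i 3 ∧ 0 < v i 0 + v i 3) ∨ ∃ q : Fin 3 → ℝ, (∀ c, IsAlgebraic ℚ (q c)) ∧ 0 < q 2 ∧ v i = Ql q) ∧ (Matrix.of v).det ≠ 0) →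
    ∀ (m : Fin 4 → ℝ), (∀ c, IsAlgebraic ℚ (m c)) →
      ∃ (N : ℕ) (ws : Fin N → Fin 4 → Fin 4 → ℝ),
        (∀ j, (∀ i c, IsAlgebraic ℚ (ws j i c)) ∧ (∀ i, (ws j i 1 ^ 2 + ws j i 2 ^ 2 = ws j i 0 * ws j i 3 ∧ 0 ≤ ws j i 3 ∧ 0 < ws j i 0 + ws j i 3) ∨ ∃ q : Fin 3 → ℝ, (∀ c, IsAlgebraic ℚ (q c)) ∧ 0 < q 2 ∧ ws j i = Ql q) ∧ (Matrix.of (ws j)).det ≠ 0) ∧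
        (∀ j, Spx (ws j) ⊆ Spx v ∩ {p | 0 < ∑ c, m c * Ql p c}) ∧
        (∀ j j', j ≠ j' → Spx (ws j) ∩ Spx (ws j') = ∅) ∧
        volume ((Spx v ∩ {p | 0 < ∑ c, m c * Ql p c}) \ ⋃ j, Spx (ws j)) = 0 := by
  intro Ql hQl Spx hSpx v hv m hm
  exact simplexCut_induct Ql hQl Spx hSpx m hm 4 v hv
    ((Finset.card_filter_le _ _).trans (by simp))

end Summit.KontsevichZagierPeriods.HyperbolicBloch.OffTetraSectorKernel

end
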